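import Summits.Ventures.HSemireg.WedgeHankelSubstitutionJordan
import Summits.Ventures.HSemireg.WedgeHankelSubstitutionSingular

/-!
# Venture HSemireg — THE SUBSTITUTIONS ON TH-7's CLASS SPACE FORM AN ANTI-REPRESENTATION OF THE MONOID `M₂(K)`: `SbC(g′) ∘ SbC(g) = SbC(g·g′)`, `SbC(1) = 1`,
# `SbC(t·g) = t^n · SbC(g)`, `SbC(t·1) = t^n · 1`, `SbC(adj g) ∘ SbC(g) = SbC(g) ∘ SbC(adj g) = (det g)^n · 1` (an explicit inverse for `det g ≠ 0`), powers of
# diagonal substitutions, and commuting letter maps give commuting class maps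

HONEST FRAMING. Part of the Lean index of the computation cell `pub-hsemireg` (seat p10 gen 20, Sunday typer «UNIFORM-IN-n»).
Finite-dimensional EXTERIOR ALGEBRA + linear algebra ONLY: no variety, no cohomology theory, no sheaf, no Ext group, no semiregularity map;
nothing here says that HC / HC_CM / HC_AV holds; no Literature fact is declared or used.  Custodian versions as in `WedgeHankelSiegelIdeal` (1/3) and `WedgeHankelFrameChange`;
the dictionary (the class space = `Sym^n` of the letters' plane, `SbC = Sym^n` read contravariantly) is QUOTED, never asserted.

WHAT IS IN THE TREE.  H1 `Sb_comp` / `Sb_Sb` (substitutions of the letters compose by the `2 × 2` matrix product, contravariantly); I1 `sbMat_comp`, `sbMat_scalar`,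
`sbMat_adj_mul` (the same for the moment MATRICES `S_c(g)`); I11 `SbC` (the restriction to the class space), `toMatrix_SbC`, `det_SbC`, `SbC_isUnit_iff`; I12 `PmC_comp_SbC`;
I18 `SbC_shear_mul_shear`, `SbC_shear_zero` (`SbC(1 0 0 1) = 1`), `SbC_shear_pow`; I20 `sbMat_scalar_mul`, `SbC_mul_self_of_det_eq_zero`.  The general composition law and
the adjugate identities were typed for `Sb` (forms) and `S_c` (matrices) but not for the restricted maps `SbC`; THIS FILE (namespace `Summit.Ventures.HSemireg.Wedge.HankelFrameChange`
continued; imports I18, I20) closes that gap: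
* §227 **`SbC_mul`: `SbC(α′ β′ γ′ δ′) * SbC(α β γ δ) = SbC(αα′+βγ′, αβ′+βδ′, γα′+δγ′, γβ′+δδ′)`** (`= SbC(g·g′)`: an ANTI-representation of the multiplicative monoid
  `M₂(K)`), `SbC_comm_of_comm` (commuting letter matrices ⇒ commuting class maps), **`SbC_scalar`** (`SbC(t 0 0 t) = t^n • 1`; `t = 1` is I18 `SbC_shear_zero`), **`SbC_smul`** (`SbC(t·g) = t^n • SbC(g)`:
  homogeneous of degree `n`), `SbC_neg` (`SbC(−g) = (−1)^n • SbC(g)`).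
* §228 **`SbC_adj_mul` / `SbC_mul_adj`: `SbC(δ, −β, −γ, α) * SbC(g) = SbC(g) * SbC(δ, −β, −γ, α) = (αδ − βγ)^n • 1`**, hence for `αδ − βγ ≠ 0` the explicit two-sided
  inverse **`SbC_mul_inv_eq_one` / `SbC_inv_mul_eq_one`** (`((αδ−βγ)^n)⁻¹ • SbC(adj g)`), `SbC_injective_of_det_ne_zero`, `SbC_surjective_of_det_ne_zero`.
* §229 DIAGONAL substitutions: **`SbC_diag_mul_diag`** (`SbC(a 0 0 d) * SbC(a′ 0 0 d′) = SbC(aa′ 0 0 dd′)`), **`SbC_diag_pow`** (`SbC(a 0 0 d)^m = SbC(a^m 0 0 d^m)`),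
  `SbC_diag_comm` — the torus acts through a commutative family (I4/I6: diagonal in th-7's spike basis with the weights of `Sym^n`).
NOT typed here: `SbC` as a bundled `MonoidHom` out of `(Matrix (Fin 2) (Fin 2) K)ᵐᵒᵖ` (no new definitions in this file); anything Ext-side.  New names only.
-/

open Module

namespace Summit.Ventures.HSemireg.Wedge.HankelFrameChange

open Summit.Ventures.HSemireg.Wedge Summit.Ventures.HSemireg.Wedge.Kunneth Summit.Ventures.HSemireg.Wedge.Hankel
  Summit.Ventures.HSemireg.Wedge.BasisFree Summit.Ventures.HSemireg.Wedge.HankelSiegel Summit.Ventures.HSemireg.Wedge.HankelSiegelIdeal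
  Summit.Ventures.HSemireg.Wedge.KunnethKernel Summit.Ventures.HSemireg.Wedge.HankelRankOne Summit.Ventures.HSemireg.Wedge.KernelDuality

variable (K : Type*) [Field K] {n : ℕ}

/-! ## §227. The composition law, scalars, homogeneity -/

/-- **THE COMPOSITION LAW ON THE CLASS SPACE: `SbC(α′ β′ γ′ δ′) * SbC(α β γ δ) = SbC(αα′ + βγ′, αβ′ + βδ′, γα′ + δγ′, γβ′ + δδ′)`** — the restricted substitutions compose by
the `2 × 2` matrix product `g·g′`, the FIRST substitution on the LEFT of the matrix product (H1 `Sb_Sb`): an anti-representation of the monoid `M₂(K)`. -/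
theorem SbC_mul (α β γ δ α' β' γ' δ' : K) :
    SbC K α' β' γ' δ' (n := n) * SbC K α β γ δ = SbC K (α * α' + β * γ') (α * β' + β * δ') (γ * α' + δ * γ') (γ * β' + δ * δ') :=
  LinearMap.ext fun f => Subtype.ext (by rw [Module.End.mul_apply, SbC_apply_coe, SbC_apply_coe, SbC_apply_coe, Sb_Sb])

/-- **commuting letter matrices give commuting class maps.** -/
theorem SbC_comm_of_comm {α β γ δ α' β' γ' δ' : K} (h1 : α * α' + β * γ' = α' * α + β' * γ) (h2 : α * β' + β * δ' = α' * β + β' * δ)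
    (h3 : γ * α' + δ * γ' = γ' * α + δ' * γ) (h4 : γ * β' + δ * δ' = γ' * β + δ' * δ) :
    SbC K α' β' γ' δ' (n := n) * SbC K α β γ δ = SbC K α β γ δ * SbC K α' β' γ' δ' := by
  rw [SbC_mul, SbC_mul, h1, h2, h3, h4]

/-- **`SbC(t 0 0 t) = t^n • 1`: scalar letter maps act by `t^n` on the classes** (I1 `sbMat_scalar`). -/
theorem SbC_scalar (t : K) : SbC K t 0 0 t (n := n) = t ^ n • (1 : spikeSpan K n →ₗ[K] spikeSpan K n) := by
  apply (LinearMap.toMatrix (spikeBasis K n) (spikeBasis K n)).injective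
  rw [toMatrix_SbC, sbMat_scalar, map_smul, LinearMap.toMatrix_one]

/-- **HOMOGENEITY: `SbC(tα, tβ, tγ, tδ) = t^n • SbC(α β γ δ)`** (I20 `sbMat_scalar_mul`). -/
theorem SbC_smul (t α β γ δ : K) : SbC K (t * α) (t * β) (t * γ) (t * δ) (n := n) = t ^ n • SbC K α β γ δ := by
  apply (LinearMap.toMatrix (spikeBasis K n) (spikeBasis K n)).injective
  rw [toMatrix_SbC, sbMat_scalar_mul, map_smul, toMatrix_SbC]

/-- `SbC(−α, −β, −γ, −δ) = (−1)^n • SbC(α β γ δ)`: `−g` acts like `g` up to the sign `(−1)^n`. -/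
theorem SbC_neg (α β γ δ : K) : SbC K (-α) (-β) (-γ) (-δ) (n := n) = (-1 : K) ^ n • SbC K α β γ δ := by
  rw [← SbC_smul, neg_one_mul, neg_one_mul, neg_one_mul, neg_one_mul]

/-! ## §228. The adjugate identities and the explicit inverse -/

/-- **`SbC(adj g) * SbC(g) = (αδ − βγ)^n • 1`** (`adj g = (δ, −β, −γ, α)`; `g · adj g = det g · 1`). -/
theorem SbC_adj_mul (α β γ δ : K) :
    SbC K δ (-β) (-γ) α (n := n) * SbC K α β γ δ = (α * δ - β * γ) ^ n • (1 : spikeSpan K n →ₗ[K] spikeSpan K n) := by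
  rw [SbC_mul, ← SbC_scalar]
  congr 1 <;> ring

/-- **`SbC(g) * SbC(adj g) = (αδ − βγ)^n • 1`** (`adj g · g = det g · 1`). -/
theorem SbC_mul_adj (α β γ δ : K) :
    SbC K α β γ δ (n := n) * SbC K δ (-β) (-γ) α = (α * δ - β * γ) ^ n • (1 : spikeSpan K n →ₗ[K] spikeSpan K n) := by
  rw [SbC_mul, ← SbC_scalar]
  congr 1 <;> ring

/-- **the explicit right inverse: `SbC(g) * (((αδ−βγ)^n)⁻¹ • SbC(adj g)) = 1`** for `αδ − βγ ≠ 0`. -/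
theorem SbC_mul_inv_eq_one {α β γ δ : K} (h : α * δ - β * γ ≠ 0) :
    SbC K α β γ δ (n := n) * (((α * δ - β * γ) ^ n)⁻¹ • SbC K δ (-β) (-γ) α) = 1 := by
  rw [mul_smul_comm, SbC_mul_adj, smul_smul, inv_mul_cancel₀ (pow_ne_zero n h), one_smul]

/-- **the explicit left inverse: `(((αδ−βγ)^n)⁻¹ • SbC(adj g)) * SbC(g) = 1`** for `αδ − βγ ≠ 0`. -/
theorem SbC_inv_mul_eq_one {α β γ δ : K} (h : α * δ - β * γ ≠ 0) :
    (((α * δ - β * γ) ^ n)⁻¹ • SbC K δ (-β) (-γ) α) * SbC K α β γ δ (n := n) = 1 := by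
  rw [smul_mul_assoc, SbC_adj_mul, smul_smul, inv_mul_cancel₀ (pow_ne_zero n h), one_smul]

/-- an invertible letter map is injective on the classes. -/
theorem SbC_injective_of_det_ne_zero {α β γ δ : K} (h : α * δ - β * γ ≠ 0) : Function.Injective (SbC K α β γ δ (n := n)) := by
  intro f g hfg
  have e := congrArg (((α * δ - β * γ) ^ n)⁻¹ • SbC K δ (-β) (-γ) α (n := n)) hfg
  rwa [← Module.End.mul_apply, ← Module.End.mul_apply, SbC_inv_mul_eq_one K h, Module.End.one_apply, Module.End.one_apply] at e

/-- … and surjective on the classes. -/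
theorem SbC_surjective_of_det_ne_zero {α β γ δ : K} (h : α * δ - β * γ ≠ 0) : Function.Surjective (SbC K α β γ δ (n := n)) := fun g =>
  ⟨(((α * δ - β * γ) ^ n)⁻¹ • SbC K δ (-β) (-γ) α (n := n)) g, by
    rw [← Module.End.mul_apply, SbC_mul_inv_eq_one K h, Module.End.one_apply]⟩

/-! ## §229. Diagonal substitutions: a commutative family -/

/-- **`SbC(a 0 0 d) * SbC(a′ 0 0 d′) = SbC(aa′ 0 0 dd′)`.** -/
theorem SbC_diag_mul_diag (a d a' d' : K) : SbC K a 0 0 d (n := n) * SbC K a' 0 0 d' = SbC K (a * a') 0 0 (d * d') := by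
  rw [SbC_mul]
  congr 1 <;> ring

/-- diagonal substitutions commute on the classes. -/
theorem SbC_diag_comm (a d a' d' : K) : SbC K a 0 0 d (n := n) * SbC K a' 0 0 d' = SbC K a' 0 0 d' * SbC K a 0 0 d := by
  rw [SbC_diag_mul_diag, SbC_diag_mul_diag, mul_comm a, mul_comm d]

/-- **`SbC(a 0 0 d)^m = SbC(a^m 0 0 d^m)`.** -/
theorem SbC_diag_pow (a d : K) (m : ℕ) : SbC K a 0 0 d (n := n) ^ m = SbC K (a ^ m) 0 0 (d ^ m) := by
  induction m with
  | zero => rw [pow_zero, pow_zero, pow_zero, SbC_shear_zero]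
  | succ m ih => rw [pow_succ, ih, SbC_diag_mul_diag, pow_succ, pow_succ]

end Summit.Ventures.HSemireg.Wedge.HankelFrameChange
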